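import Mathlib
import HarnessLib
import Literature.Probability.LatticeModels.LatticeGraph

/-!
# BalabanIR engine `BirComplexStableXY` (stmt-HubbardSuperconductivity-2080): slicing the typed
objects (`r = 2`) — two-slice transfer kernel, factorisation, currying of the cube

Support lemmas for crux 2 of route BalabanIR (`--supports stmt-HubbardSuperconductivity-2080`),
model-specific part, consumed by `BalabanIRBirComplexStableXYEvenPositivity.lean`.  For the
objects EXACTLY as typed in `Theses.BalabanIR.BirComplexStableXY` with `r = 2` (same `sh`, `F`,
`A`, `cube`, `O`):

* `birAction_factorises` — reading a space-time configuration slice by slice,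
  `θ (x, τ) = σ τ x`, the weight factorises over consecutive time slices,
  `exp(-A θ) = ∏_τ k(σ_τ, σ_{τ+1})`, with the two-slice kernel
  `k(η, η') = exp(-K Σ_x F(window_x(η, η')))`, `window_x(η,η') w = (![η,η'] w₃)(x + (w₁,w₂))`;
* `birKernel_continuous_bound` — `k` is jointly continuous, uniformly bounded, nowhere zero;
* `birKernel_herm` — under the time-reflection reality hypothesis (R) `F (φ ∘ R) = conj (F φ)`
  of the item record the kernel is HERMITIAN, `k(η', η) = conj k(η, η')`;
* `birCurry_measurePreserving` — slicing is a measure-preserving equivalence between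
  `∏_{τ : ZMod M} [0,2π]^X` and the space-time cube `[0,2π]^Λ` (Lebesgue);
* `birSliceCube_nhds_pos` — every point of the slice cube has all open neighbourhoods of positive
  restricted Lebesgue measure (the cube is the closure of its interior);
* `birSliceObservable_continuous_bound` — the slice observable `|L⁻² Σ_x e^{iθ(x,0)}|²` is
  continuous with values in `[0, 1]`.
-/

namespace Summit.HubbardSuperconductivity.HubbardSuperconductivity.Theorems

open scoped BigOperators ComplexConjugate
open MeasureTheory
open Literature.Probability.LatticeModels

section Kernel

variable {L : ℕ} [NeZero L]

omit [NeZero L] in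
/-- The two-slice window configuration `w ↦ (![η, η'] w₃) (x + (w₁, w₂))` depends continuously
(indeed linearly) on the pair of slices `(η, η')`. -/
theorem birWindow_continuous (x : TorusSite 2 L) :
    Continuous (fun p : (TorusSite 2 L → ℝ) × (TorusSite 2 L → ℝ) =>
      fun w : Fin 2 × Fin 2 × Fin 2 =>
        (![p.1, p.2] w.2.2) (x + ![((w.1 : ℕ) : ZMod L), ((w.2.1 : ℕ) : ZMod L)])) := by
  refine continuous_pi fun w => ?_
  obtain ⟨w1, w2, w3⟩ := w
  fin_cases w3
  · exact (continuous_apply _).comp continuous_fst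
  · exact (continuous_apply _).comp continuous_snd

omit [NeZero L] in
/-- Swapping the two slices is the temporal reflection `w₃ ↦ rev w₃` of the window. -/
theorem birWindow_swap (x : TorusSite 2 L) (η η' : TorusSite 2 L → ℝ) :
    (fun w : Fin 2 × Fin 2 × Fin 2 =>
        (![η', η] w.2.2) (x + ![((w.1 : ℕ) : ZMod L), ((w.2.1 : ℕ) : ZMod L)])) =
      fun w => (fun w' : Fin 2 × Fin 2 × Fin 2 =>
        (![η, η'] w'.2.2) (x + ![((w'.1 : ℕ) : ZMod L), ((w'.2.1 : ℕ) : ZMod L)]))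
          (w.1, w.2.1, Fin.rev w.2.2) := by
  funext w
  obtain ⟨w1, w2, w3⟩ := w
  fin_cases w3 <;> rfl

/-- A local generating function given by a finite Fourier table is continuous and bounded by
the `ℓ¹` norm of the table on real configurations. -/
theorem birLocalF_continuous_bound {W : Type*} [Fintype W] (c : (W → ℤ) →₀ ℂ) :
    Continuous (fun φ : W → ℝ =>
      c.sum (fun n a => a * Complex.exp (Complex.I * ((∑ w, (n w : ℝ) * φ w : ℝ) : ℂ)))) ∧
    ∀ φ : W → ℝ, ‖c.sum (fun n a => a * Complex.exp (Complex.I * ((∑ w, (n w : ℝ) * φ w : ℝ) : ℂ)))‖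
      ≤ ∑ n ∈ c.support, ‖c n‖ := by
  refine ⟨?_, fun φ => ?_⟩
  · simp only [Finsupp.sum]
    refine continuous_finsetSum _ fun n _ => continuous_const.mul ?_
    refine Complex.continuous_exp.comp (continuous_const.mul ?_)
    exact Complex.continuous_ofReal.comp
      (continuous_finsetSum _ fun w _ => continuous_const.mul (continuous_apply w))
  · simp only [Finsupp.sum]
    refine (norm_sum_le _ _).trans (Finset.sum_le_sum fun n _ => ?_)
    rw [norm_mul, Complex.norm_exp_I_mul_ofReal, mul_one]

/-- The two-slice transfer kernel `k(η, η') = exp(-K Σ_x F(window_x(η, η')))` of a window action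
of temporal range two is jointly continuous, uniformly bounded and nowhere zero. -/
theorem birKernel_continuous_bound (Fw : (Fin 2 × Fin 2 × Fin 2 → ℝ) → ℂ) (hFc : Continuous Fw)
    {CF : ℝ} (hCF : ∀ φ, ‖Fw φ‖ ≤ CF) (K : ℝ) :
    Continuous (Function.uncurry fun η η' : TorusSite 2 L → ℝ =>
      Complex.exp (-((K : ℂ) * ∑ x : TorusSite 2 L, Fw (fun w =>
        (![η, η'] w.2.2) (x + ![((w.1 : ℕ) : ZMod L), ((w.2.1 : ℕ) : ZMod L)]))))) ∧
    (∀ η η' : TorusSite 2 L → ℝ, ‖Complex.exp (-((K : ℂ) * ∑ x : TorusSite 2 L, Fw (fun w =>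
        (![η, η'] w.2.2) (x + ![((w.1 : ℕ) : ZMod L), ((w.2.1 : ℕ) : ZMod L)]))))‖
      ≤ Real.exp (|K| * (Fintype.card (TorusSite 2 L) * CF))) ∧
    ∀ η η' : TorusSite 2 L → ℝ, Complex.exp (-((K : ℂ) * ∑ x : TorusSite 2 L, Fw (fun w =>
        (![η, η'] w.2.2) (x + ![((w.1 : ℕ) : ZMod L), ((w.2.1 : ℕ) : ZMod L)])))) ≠ 0 := by
  refine ⟨?_, fun η η' => ?_, fun η η' => Complex.exp_ne_zero _⟩
  · refine Complex.continuous_exp.comp (Continuous.neg (continuous_const.mul ?_))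
    refine continuous_finsetSum _ fun x _ => ?_
    exact hFc.comp (birWindow_continuous x)
  · rw [Complex.norm_exp]
    refine Real.exp_le_exp.mpr ?_
    have hS : ‖∑ x : TorusSite 2 L, Fw (fun w =>
        (![η, η'] w.2.2) (x + ![((w.1 : ℕ) : ZMod L), ((w.2.1 : ℕ) : ZMod L)]))‖
        ≤ Fintype.card (TorusSite 2 L) * CF := by
      refine (norm_sum_le _ _).trans ?_
      calc ∑ x : TorusSite 2 L, ‖Fw (fun w =>
              (![η, η'] w.2.2) (x + ![((w.1 : ℕ) : ZMod L), ((w.2.1 : ℕ) : ZMod L)]))‖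
          ≤ ∑ _x : TorusSite 2 L, CF := Finset.sum_le_sum fun x _ => hCF _
        _ = Fintype.card (TorusSite 2 L) * CF := by simp
    calc (-((K : ℂ) * ∑ x : TorusSite 2 L, Fw (fun w =>
            (![η, η'] w.2.2) (x + ![((w.1 : ℕ) : ZMod L), ((w.2.1 : ℕ) : ZMod L)])))).re
        ≤ ‖-((K : ℂ) * ∑ x : TorusSite 2 L, Fw (fun w =>
            (![η, η'] w.2.2) (x + ![((w.1 : ℕ) : ZMod L), ((w.2.1 : ℕ) : ZMod L)])))‖ :=
          Complex.re_le_norm _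
      _ ≤ |K| * (Fintype.card (TorusSite 2 L) * CF) := by
          rw [norm_neg, norm_mul, Complex.norm_real, Real.norm_eq_abs]
          exact mul_le_mul_of_nonneg_left hS (abs_nonneg K)

/-- **Time-reflection reality makes the transfer kernel Hermitian.** If the local generating
function satisfies (R) `F (φ ∘ R) = conj (F φ)` then `k(η', η) = conj k(η, η')` for every real
`K`. -/
theorem birKernel_herm (Fw : (Fin 2 × Fin 2 × Fin 2 → ℝ) → ℂ)
    (hRw : ∀ φ : Fin 2 × Fin 2 × Fin 2 → ℝ, Fw (fun w => φ (w.1, w.2.1, Fin.rev w.2.2)) = conj (Fw φ))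
    (K : ℝ) (η η' : TorusSite 2 L → ℝ) :
    Complex.exp (-((K : ℂ) * ∑ x : TorusSite 2 L, Fw (fun w =>
        (![η', η] w.2.2) (x + ![((w.1 : ℕ) : ZMod L), ((w.2.1 : ℕ) : ZMod L)])))) =
      conj (Complex.exp (-((K : ℂ) * ∑ x : TorusSite 2 L, Fw (fun w =>
        (![η, η'] w.2.2) (x + ![((w.1 : ℕ) : ZMod L), ((w.2.1 : ℕ) : ZMod L)]))))) := by
  rw [← Complex.exp_conj, map_neg, map_mul, Complex.conj_ofReal, map_sum]
  congr 3
  refine Finset.sum_congr rfl fun x _ => ?_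
  rw [← hRw, birWindow_swap x η η']

end Kernel

section Slicing

/-- **Factorisation over time slices (`r = 2`).** Reading a space-time configuration slice by
slice, `θ (x, τ) = σ τ x`, the weight of the window action of `BirComplexStableXY` with `r = 2`
is the cyclic product of two-slice kernels: `exp(-A θ) = ∏_τ k(σ_τ, σ_{τ+1})`. -/
theorem birAction_factorises (c : ((Fin 2 × Fin 2 × Fin 2) → ℤ) →₀ ℂ) (K : ℝ) (L M : ℕ)
    [NeZero L] [NeZero M] (σ : ZMod M → TorusSite 2 L → ℝ) :
    let sh : (TorusSite 2 L × ZMod M) → (Fin 2 × Fin 2 × Fin 2) → (TorusSite 2 L × ZMod M) :=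
      fun s w => (s.1 + ![((w.1 : ℕ) : ZMod L), ((w.2.1 : ℕ) : ZMod L)], s.2 + ((w.2.2 : ℕ) : ZMod M))
    let F : ((Fin 2 × Fin 2 × Fin 2) → ℝ) → ℂ := fun φ =>
      c.sum (fun n a => a * Complex.exp (Complex.I * ((∑ w, (n w : ℝ) * φ w : ℝ) : ℂ)))
    let A : ((TorusSite 2 L × ZMod M) → ℝ) → ℂ := fun θ => (K : ℂ) * ∑ s, F (fun w => θ (sh s w))
    Complex.exp (-(A (fun s => σ s.2 s.1))) =
      ∏ τ : ZMod M, Complex.exp (-((K : ℂ) * ∑ x : TorusSite 2 L, F (fun w =>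
        (![σ τ, σ (τ + 1)] w.2.2) (x + ![((w.1 : ℕ) : ZMod L), ((w.2.1 : ℕ) : ZMod L)])))) := by
  intro sh F A
  have hwin : ∀ (x : TorusSite 2 L) (τ : ZMod M),
      (fun w : Fin 2 × Fin 2 × Fin 2 => σ (sh (x, τ) w).2 (sh (x, τ) w).1) =
        fun w => (![σ τ, σ (τ + 1)] w.2.2) (x + ![((w.1 : ℕ) : ZMod L), ((w.2.1 : ℕ) : ZMod L)]) := by
    intro x τ
    funext w
    obtain ⟨w1, w2, w3⟩ := w
    fin_cases w3
    · simp [sh]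
    · simp [sh]
  show Complex.exp (-((K : ℂ) * ∑ s : TorusSite 2 L × ZMod M,
      F (fun w => σ (sh s w).2 (sh s w).1))) = _
  have hsplit := Fintype.sum_prod_type_right (fun s : TorusSite 2 L × ZMod M =>
    F (fun w => σ (sh s w).2 (sh s w).1))
  rw [hsplit, Finset.mul_sum, ← Complex.exp_sum]
  congr 1
  rw [← Finset.sum_neg_distrib]
  simp only [hwin]

/-- The slice observable: `O θ = |L⁻² Σ_x e^{iθ(x,0)}|²` reads only slice `0`. -/
theorem birSliceObservable_slice (L M : ℕ) [NeZero L] [NeZero M]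
    (σ : ZMod M → TorusSite 2 L → ℝ) :
    ‖∑ x : TorusSite 2 L, Complex.exp (Complex.I * ((fun s : TorusSite 2 L × ZMod M => σ s.2 s.1)
        (x, 0) : ℂ))‖ ^ 2 / (L : ℝ) ^ 4 =
      ‖∑ x : TorusSite 2 L, Complex.exp (Complex.I * (σ 0 x : ℂ))‖ ^ 2 / (L : ℝ) ^ 4 := rfl

/-- The slice observable is continuous and takes values in `[0, 1]`. -/
theorem birSliceObservable_continuous_bound (L : ℕ) [NeZero L] :
    Continuous (fun a : TorusSite 2 L → ℝ =>
      ‖∑ x : TorusSite 2 L, Complex.exp (Complex.I * (a x : ℂ))‖ ^ 2 / (L : ℝ) ^ 4) ∧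
    ∀ a : TorusSite 2 L → ℝ,
      0 ≤ ‖∑ x : TorusSite 2 L, Complex.exp (Complex.I * (a x : ℂ))‖ ^ 2 / (L : ℝ) ^ 4 ∧
      ‖∑ x : TorusSite 2 L, Complex.exp (Complex.I * (a x : ℂ))‖ ^ 2 / (L : ℝ) ^ 4 ≤ 1 := by
  refine ⟨?_, fun a => ⟨by positivity, ?_⟩⟩
  · refine ((continuous_finsetSum _ fun x _ => ?_).norm.pow 2).div_const _
    exact Complex.continuous_exp.comp (continuous_const.mul
      (Complex.continuous_ofReal.comp (continuous_apply x)))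
  · have hcard : (Fintype.card (TorusSite 2 L) : ℝ) = (L : ℝ) ^ 2 := by
      simp [TorusSite, ZMod.card]
    have hsum : ‖∑ x : TorusSite 2 L, Complex.exp (Complex.I * (a x : ℂ))‖ ≤ (L : ℝ) ^ 2 := by
      refine (norm_sum_le _ _).trans ?_
      simp only [Complex.norm_exp_I_mul_ofReal, Finset.sum_const, Finset.card_univ, nsmul_eq_mul,
        mul_one]
      exact hcard.le
    have hL : (0 : ℝ) < (L : ℝ) ^ 4 := by
      have : (0 : ℝ) < L := by exact_mod_cast Nat.pos_of_ne_zero (NeZero.ne L)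
      positivity
    rw [div_le_one hL]
    calc ‖∑ x : TorusSite 2 L, Complex.exp (Complex.I * (a x : ℂ))‖ ^ 2 ≤ ((L : ℝ) ^ 2) ^ 2 :=
          pow_le_pow_left₀ (norm_nonneg _) hsum 2
      _ = (L : ℝ) ^ 4 := by ring

/-- **Currying the cube.** Reading configurations slice by slice is a measure-preserving
equivalence between the product over `τ : ZMod M` of the slice cubes `[0,2π]^X` (Lebesgue) and the
space-time cube `[0,2π]^Λ`. -/
theorem birCurry_measurePreserving (L M : ℕ) [NeZero L] [NeZero M] :
    ∃ e : (ZMod M → TorusSite 2 L → ℝ) ≃ᵐ ((TorusSite 2 L × ZMod M) → ℝ),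
      (∀ σ, e σ = fun s => σ s.2 s.1) ∧
      MeasurePreserving e
        (Measure.pi fun _ : ZMod M => (volume : Measure (TorusSite 2 L → ℝ)).restrict
          (Set.pi Set.univ fun _ => Set.Icc (0 : ℝ) (2 * Real.pi)))
        (volume.restrict (Set.pi Set.univ fun _ => Set.Icc (0 : ℝ) (2 * Real.pi))) := by
  let e : (ZMod M → TorusSite 2 L → ℝ) ≃ᵐ ((TorusSite 2 L × ZMod M) → ℝ) :=
    { toFun := fun σ s => σ s.2 s.1
      invFun := fun θ τ x => θ (x, τ)
      left_inv := fun σ => rfl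
      right_inv := fun θ => rfl
      measurable_toFun := by
        refine measurable_pi_lambda _ fun s => ?_
        exact (measurable_pi_apply s.1).comp (measurable_pi_apply s.2)
      measurable_invFun := by
        refine measurable_pi_lambda _ fun τ => measurable_pi_lambda _ fun x => ?_
        exact measurable_pi_apply (x, τ) }
  have he : ∀ σ, e σ = fun s => σ s.2 s.1 := fun σ => rfl
  refine ⟨e, he, ?_⟩
  -- unrestricted: both sides are Lebesgue
  have hvol : MeasurePreserving e
      (Measure.pi fun _ : ZMod M => (volume : Measure (TorusSite 2 L → ℝ))) volume := by
    refine ⟨e.measurable, ?_⟩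
    show Measure.map e _ = Measure.pi fun _ => volume
    refine (Measure.pi_eq fun s hs => ?_).symm
    rw [Measure.map_apply e.measurable (MeasurableSet.univ_pi hs)]
    have hpre : e ⁻¹' (Set.pi Set.univ s) =
        Set.pi Set.univ (fun τ => Set.pi Set.univ (fun x => s (x, τ))) := by
      ext σ
      simp only [Set.mem_preimage, Set.mem_univ_pi, he]
      exact ⟨fun h τ x => h (x, τ), fun h s => h s.2 s.1⟩
    rw [hpre, Measure.pi_pi]
    simp_rw [volume_pi, Measure.pi_pi]
    exact (Fintype.prod_prod_type_right fun i : TorusSite 2 L × ZMod M =>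
      (volume : Measure ℝ) (s i)).symm
  have hcube : MeasurableSet (Set.pi Set.univ fun _ : TorusSite 2 L × ZMod M =>
      Set.Icc (0 : ℝ) (2 * Real.pi)) := MeasurableSet.univ_pi fun _ => measurableSet_Icc
  have h := hvol.restrict_preimage hcube
  have hpre : e ⁻¹' (Set.pi Set.univ fun _ : TorusSite 2 L × ZMod M => Set.Icc (0 : ℝ) (2 * Real.pi))
      = Set.pi Set.univ (fun _ : ZMod M =>
          Set.pi Set.univ (fun _ : TorusSite 2 L => Set.Icc (0 : ℝ) (2 * Real.pi))) := by
    ext σ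
    simp only [Set.mem_preimage, Set.mem_univ_pi, he]
    exact ⟨fun h τ x => h (x, τ), fun h s => h s.2 s.1⟩
  rw [hpre, Measure.restrict_pi_pi] at h
  exact h

/-- Every point of the slice cube `[0,2π]^X` has all its open neighbourhoods of positive mass
for Lebesgue measure restricted to the cube (the cube is the closure of its interior). -/
theorem birSliceCube_nhds_pos {ι : Type*} [Fintype ι] (a : ι → ℝ)
    (ha : a ∈ Set.pi Set.univ (fun _ : ι => Set.Icc (0 : ℝ) (2 * Real.pi))) (U : Set (ι → ℝ))
    (hU : IsOpen U) (haU : a ∈ U) :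
    0 < (volume.restrict (Set.pi Set.univ (fun _ : ι => Set.Icc (0 : ℝ) (2 * Real.pi)))) U := by
  have hint : interior (Set.pi Set.univ (fun _ : ι => Set.Icc (0 : ℝ) (2 * Real.pi))) =
      Set.pi Set.univ (fun _ : ι => Set.Ioo (0 : ℝ) (2 * Real.pi)) := by
    rw [interior_pi_set Set.finite_univ]
    simp
  have hclos : closure (Set.pi Set.univ (fun _ : ι => Set.Ioo (0 : ℝ) (2 * Real.pi))) =
      Set.pi Set.univ (fun _ : ι => Set.Icc (0 : ℝ) (2 * Real.pi)) := by
    rw [closure_pi_set]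
    simp [closure_Ioo Real.two_pi_pos.ne]
  have ha' : a ∈ closure (Set.pi Set.univ (fun _ : ι => Set.Ioo (0 : ℝ) (2 * Real.pi))) := by
    rwa [hclos]
  obtain ⟨b, hbU, hb⟩ := mem_closure_iff.mp ha' U hU haU
  have hopen : IsOpen (U ∩ Set.pi Set.univ (fun _ : ι => Set.Ioo (0 : ℝ) (2 * Real.pi))) :=
    hU.inter (isOpen_set_pi Set.finite_univ fun _ _ => isOpen_Ioo)
  have hpos : 0 < volume (U ∩ Set.pi Set.univ (fun _ : ι => Set.Ioo (0 : ℝ) (2 * Real.pi))) :=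
    hopen.measure_pos volume ⟨b, hbU, hb⟩
  rw [Measure.restrict_apply' (MeasurableSet.univ_pi fun _ => measurableSet_Icc)]
  refine hpos.trans_le (measure_mono (Set.inter_subset_inter_right _ ?_))
  exact Set.pi_mono fun _ _ => Set.Ioo_subset_Icc_self

end Slicing

end Summit.HubbardSuperconductivity.HubbardSuperconductivity.Theorems
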